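import Summits.RiemannHypothesis.RiemannHypothesis.Theorems.PfPersistenceHalfLineBiasMellin
import Literature.NumberTheory.LFunctions.ZetaScrewThm17Proofs
import HarnessLib

/-!
# LANDAU for the half-line Chebyshev bias — V: the screw identity and Suzuki 2024 Thm 1 (i) ⇒ (ii), (iii)

Cell `pub-rhpf` (mechanism/rigidity campaign; **no RH claims**), CAND SEAT 7 gen 8, CASE-DAG v6 §6
kernel target LANDAU. The half-line Chebyshev bias `B(x) = Σ_{n≤x} Λ(n) n^{-1/2} log(x/n) − 4√x`
(`hlb`, `= chebyshevHalfLineBias`, Suzuki 2024) and Suzuki's SCREW FUNCTION `Ψ` of `ζ`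
(`zetaScrew`, Suzuki 2023 (1.1)) share the prime sum `Σ_{n ≤ e^t} Λ(n) n^{-1/2}(t − log n)`
(`wR_eq_zetaScrewPrimeSum`), whence the exact, unconditional SCREW IDENTITY (`hlb_add_zetaScrew`)

  `B(x) + Ψ(log x) = 4 x^{-1/2} − 8 − (log x)/2 · L + (1/4)(C − x^{-1/2} Φ(x^{-2}, 2, 1/4))`, `x ≥ 1`,

with `L = γ₀ + π/2 + 3 log 2 + log π` (`= log π − (Γ'/Γ)(1/4) ≈ 5.37`) and `C = ζ(2, 1/4)`; crude
numerics (`C ≤ 8π²/3`, `L ≥ 5`) give the unconditional `B(x) + Ψ(log x) ≤ 3 − (5/2) log x`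
(`hlb_add_zetaScrew_le`). Since RH ⇒ `Ψ ≥ 0` is PROVED in the tree
(`ZetaScrewThm17.zetaScrew_nonneg_of_RH`, Suzuki 2023 Thm 1.7 via Thm 1.1 (2)), this yields

* `hlb_le_of_riemannHypothesis`: RH ⇒ `B(x) ≤ 3 − (5/2) log x` for `x ≥ 1`;
* `chebyshevHalfLineBias_nonpos_of_riemannHypothesis`: RH ⇒ `B(x) ≤ 0` for `x ≥ 4`, i.e.
  **Suzuki 2024 Thm 1 (i) ⇒ (ii)** (`suzuki2024_thm1_mp`, with the explicit `x₀ = 4`);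
* `tendsto_hlb_atBot_of_riemannHypothesis`: RH ⇒ `B(x) → −∞` (Suzuki 2024 Thm 1 (i) ⇒ (iii)).

Together with the RH-free direction (ii) ⇒ (i) (MV 15.3 for `B`, files
`PfPersistenceHalfLineBias{Landau,Dictionary}`) this discharges the named fact `Suzuki2024_thm1`
(done in the dictionary's sequel, which imports both). For the cell: the upper `O(1)` reader of `B`
is SOUND under RH (hence exactly RH-strength), and — unconditionally — `lim inf B = −∞`.
Sorry-free; the only RH-dependence is through the displayed hypotheses.

References: M. Suzuki, *Aspects of the screw function corresponding to the Riemann zeta-function*,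
J. Lond. Math. Soc. 108 (2023), arXiv:2206.03682 [Suzuki2023]; M. Suzuki, arXiv:2411.07436 (2024),
Thm. 1 [Suzuki2024].
-/

noncomputable section

-- the sub-problem path RiemannHypothesis/RiemannHypothesis duplicates a namespace (D-0017)
set_option linter.dupNamespace false

open Filter Topology Set

namespace Summit.RiemannHypothesis.RiemannHypothesis.Theorems.PfPersistenceHalfLineBiasScrew

open Literature.NumberTheory.LFunctions
open Summit.RiemannHypothesis.RiemannHypothesis.Theorems.PfPersistenceDilatingLandauWeightedMellin
open Summit.RiemannHypothesis.RiemannHypothesis.Theorems.PfPersistenceHalfLineBiasMellin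

/-! ## §1 The screw identity -/

/-- The log-Riesz mean `R(x) = Σ_{n≤x} Λ(n) n^{-1/2} log(x/n)` is Suzuki's prime sum `φ` of the screw
function at `t = log x` (`x ≥ 1`). [cite: Suzuki2023, (1.1) and Prop. 2.1; Suzuki2024, (1.5)] -/
theorem wR_eq_zetaScrewPrimeSum {x : ℝ} (hx : 1 ≤ x) : wR x = zetaScrewPrimeSum (Real.log x) := by
  have hx0 : 0 < x := by linarith
  rw [wR_eq hx0, zetaScrewPrimeSum, abs_of_nonneg (Real.log_nonneg hx), Real.exp_log hx0]
  refine Finset.sum_congr rfl fun n hn ↦ ?_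
  have hn0 : (0 : ℝ) < n := by exact_mod_cast (Finset.mem_Icc.1 hn).1
  rw [wcoef, Real.sqrt_eq_rpow, Real.log_div hx0.ne' hn0.ne']

/-- `e^{(log x)/2} = x^{1/2}` for `x > 0`. [folklore] -/
theorem exp_log_half {x : ℝ} (hx : 0 < x) : Real.exp (Real.log x / 2) = x ^ (1 / 2 : ℝ) := by
  rw [Real.rpow_def_of_pos hx]; congr 1; ring

/-- `e^{-(log x)/2} = x^{-1/2}` for `x > 0`. [folklore] -/
theorem exp_neg_log_half {x : ℝ} (hx : 0 < x) :
    Real.exp (-(Real.log x / 2)) = x ^ (-(1 / 2 : ℝ)) := by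
  rw [Real.rpow_def_of_pos hx]; congr 1; ring

/-- **The screw identity** (unconditional): for `x ≥ 1`,
`B(x) + Ψ(log x) = 4x^{-1/2} − 8 − (log x)/2·(γ₀ + π/2 + 3 log 2 + log π)
  + (1/4)(Σ_k (k+1/4)^{-2} − x^{-1/2} Φ(e^{-2 log x}, 2, 1/4))`.
[cite: Suzuki2023, (1.1); Suzuki2024, (1.5)] -/
theorem hlb_add_zetaScrew {x : ℝ} (hx : 1 ≤ x) :
    hlb x + zetaScrew (Real.log x) =
      4 * x ^ (-(1 / 2 : ℝ)) - 8
        - Real.log x / 2 * (Real.eulerMascheroniConstant + Real.pi / 2 + 3 * Real.log 2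
            + Real.log Real.pi)
        + (1 / 4) * ((∑' k : ℕ, 1 / ((k : ℝ) + 1 / 4) ^ 2)
            - x ^ (-(1 / 2 : ℝ)) * hurwitzLerchQuarter (Real.log x)) := by
  have hx0 : 0 < x := by linarith
  rw [zetaScrew_eq, ← wR_eq_zetaScrewPrimeSum hx, abs_of_nonneg (Real.log_nonneg hx),
    exp_log_half hx0, exp_neg_log_half hx0, hlb]
  ring

/-- Dropping the non-negative Hurwitz–Lerch term: for `x ≥ 1`,
`B(x) + Ψ(log x) ≤ 4x^{-1/2} − 8 + C/4 − (log x)/2 · L`. [cite: Suzuki2023, (1.1)] -/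
theorem hlb_add_zetaScrew_le' {x : ℝ} (hx : 1 ≤ x) :
    hlb x + zetaScrew (Real.log x) ≤
      4 * x ^ (-(1 / 2 : ℝ)) - 8 + (1 / 4) * (∑' k : ℕ, 1 / ((k : ℝ) + 1 / 4) ^ 2)
        - Real.log x / 2 * (Real.eulerMascheroniConstant + Real.pi / 2 + 3 * Real.log 2
            + Real.log Real.pi) := by
  have hx0 : 0 < x := by linarith
  rw [hlb_add_zetaScrew hx]
  have hH : 0 ≤ x ^ (-(1 / 2 : ℝ)) * hurwitzLerchQuarter (Real.log x) :=
    mul_nonneg (Real.rpow_nonneg hx0.le _) (hurwitzLerchQuarter_nonneg _)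
  linarith

/-! ## §2 Crude numerics: `C ≤ 8π²/3 < 26.46`, `L ≥ 5` -/

/-- `C = ζ(2, 1/4) = Σ_{k≥0} (k + 1/4)^{-2} ≤ 16 Σ_{k≥0} (k+1)^{-2} = 8π²/3`
(termwise `(k+1)² ≤ (4k+1)²`). [folklore] -/
theorem tsum_quarter_sq_le : (∑' k : ℕ, 1 / ((k : ℝ) + 1 / 4) ^ 2) ≤ 8 * Real.pi ^ 2 / 3 := by
  have hz : HasSum (fun k : ℕ ↦ (1 : ℝ) / ((k + 1 : ℕ) : ℝ) ^ 2) (Real.pi ^ 2 / 6) := by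
    have h := (hasSum_nat_add_iff' 1).2 hasSum_zeta_two
    simpa using h
  have hg : HasSum (fun k : ℕ ↦ (16 : ℝ) / ((k : ℝ) + 1) ^ 2) (8 * Real.pi ^ 2 / 3) := by
    have h16 := hz.mul_left 16
    have h8 : (16 : ℝ) * (Real.pi ^ 2 / 6) = 8 * Real.pi ^ 2 / 3 := by ring
    rw [h8] at h16
    refine h16.congr_fun fun k ↦ ?_
    push_cast
    ring
  refine hg.tsum_eq ▸ summable_one_div_nat_add_quarter_sq.tsum_le_tsum (fun k ↦ ?_) hg.summable
  have hk : (0 : ℝ) ≤ k := Nat.cast_nonneg k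
  rw [div_le_div_iff₀ (by positivity) (by positivity), one_mul]
  nlinarith [sq_nonneg ((k : ℝ) + 1), sq_nonneg (k : ℝ)]

/-- `C/4 ≤ 27/4 − 1/8` (any explicit bound below `7` will do; from `π < 3.15`). [folklore] -/
theorem quarter_tsum_quarter_sq_le :
    (1 / 4 : ℝ) * (∑' k : ℕ, 1 / ((k : ℝ) + 1 / 4) ^ 2) ≤ 663 / 100 := by
  have hπ := Real.pi_lt_d2
  have hπ0 := Real.pi_pos.le
  have hsq : Real.pi ^ 2 ≤ 3.15 ^ 2 := by
    rw [sq, sq]; exact mul_le_mul hπ.le hπ.le hπ0 (by norm_num)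
  have h := tsum_quarter_sq_le
  nlinarith

/-- `L = γ₀ + π/2 + 3 log 2 + log π ≥ 5` (`γ₀ > 1/2`, `π > 3`, `log 2 > 0.693`, `log π > 1`).
[folklore] -/
theorem five_le_screwSlope :
    (5 : ℝ) ≤ Real.eulerMascheroniConstant + Real.pi / 2 + 3 * Real.log 2 + Real.log Real.pi := by
  have hγ := Real.one_half_lt_eulerMascheroniConstant
  have hπ := Real.pi_gt_three
  have h2 := Real.log_two_gt_d9
  have hlogπ : 1 < Real.log Real.pi := by
    rw [Real.lt_log_iff_exp_lt Real.pi_pos]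
    have he := Real.exp_one_lt_d9
    linarith
  linarith

/-- **Unconditional one-line bound** `B(x) + Ψ(log x) ≤ 3 − (5/2) log x` for `x ≥ 1`.
[cite: Suzuki2023, (1.1); Suzuki2024, (1.5)] -/
theorem hlb_add_zetaScrew_le {x : ℝ} (hx : 1 ≤ x) :
    hlb x + zetaScrew (Real.log x) ≤ 3 - 5 / 2 * Real.log x := by
  have h := hlb_add_zetaScrew_le' hx
  have hC := quarter_tsum_quarter_sq_le
  have hL := five_le_screwSlope
  have hxr : x ^ (-(1 / 2 : ℝ)) ≤ 1 := Real.rpow_le_one_of_one_le_of_nonpos hx (by norm_num)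
  have hlog : 0 ≤ Real.log x := Real.log_nonneg hx
  nlinarith

/-! ## §3 Under RH: Suzuki 2024 Thm 1 (i) ⇒ (ii) and (i) ⇒ (iii) -/

/-- **RH ⇒ `B(x) ≤ 3 − (5/2) log x`** for `x ≥ 1` (RH ⇒ `Ψ ≥ 0`, Suzuki 2023 Thm 1.7, proved in the
tree as `ZetaScrewThm17.zetaScrew_nonneg_of_RH`). [cite: Suzuki2023, Thm 1.7; Suzuki2024, Thm 1] -/
theorem hlb_le_of_riemannHypothesis (hRH : RiemannHypothesis) {x : ℝ} (hx : 1 ≤ x) :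
    hlb x ≤ 3 - 5 / 2 * Real.log x := by
  have h := hlb_add_zetaScrew_le hx
  have hΨ := ZetaScrewThm17.zetaScrew_nonneg_of_RH hRH (Real.log x)
  linarith

/-- **RH ⇒ `B(x) ≤ 0` for `x ≥ 4`** (`(5/2) log 4 > 3`). [cite: Suzuki2024, Thm 1 ((i) ⇒ (ii))] -/
theorem hlb_nonpos_of_riemannHypothesis (hRH : RiemannHypothesis) {x : ℝ} (hx : 4 ≤ x) :
    hlb x ≤ 0 := by
  have h := hlb_le_of_riemannHypothesis hRH (by linarith : (1 : ℝ) ≤ x)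
  have h4 : Real.log 4 ≤ Real.log x := Real.log_le_log (by norm_num) hx
  have hlog4 : (1.38 : ℝ) < Real.log 4 := by
    have : Real.log 4 = 2 * Real.log 2 := by
      rw [show (4 : ℝ) = 2 ^ 2 by norm_num, Real.log_pow]; norm_num
    rw [this]; linarith [Real.log_two_gt_d9]
  linarith

/-- **RH ⇒ `chebyshevHalfLineBias x ≤ 0` for `x ≥ 4`.** [cite: Suzuki2024, Thm 1 ((i) ⇒ (ii))] -/
theorem chebyshevHalfLineBias_nonpos_of_riemannHypothesis (hRH : RiemannHypothesis) {x : ℝ}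
    (hx : 4 ≤ x) : chebyshevHalfLineBias x ≤ 0 := by
  rw [← hlb_eq_chebyshevHalfLineBias (by linarith)]
  exact hlb_nonpos_of_riemannHypothesis hRH hx

/-- **Suzuki 2024 Theorem 1, (i) ⇒ (ii)**, in the printed shape of `Suzuki2024_thm1` (with `x₀ = 4`).
[cite: Suzuki2024, Thm 1] -/
theorem suzuki2024_thm1_mp (hRH : RiemannHypothesis) :
    ∃ x₀ : ℝ, 2 ≤ x₀ ∧ ∀ x : ℝ, x₀ ≤ x → chebyshevHalfLineBias x ≤ 0 :=
  ⟨4, by norm_num, fun _ hx ↦ chebyshevHalfLineBias_nonpos_of_riemannHypothesis hRH hx⟩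

/-- **RH ⇒ `B(x) → −∞`** (Suzuki 2024 Thm 1 (i) ⇒ (iii)). [cite: Suzuki2024, Thm 1] -/
theorem tendsto_hlb_atBot_of_riemannHypothesis (hRH : RiemannHypothesis) :
    Tendsto hlb atTop atBot := by
  have hlin : Tendsto (fun x : ℝ ↦ 3 - 5 / 2 * Real.log x) atTop atBot := by
    have h1 : Tendsto (fun x : ℝ ↦ 5 / 2 * Real.log x) atTop atTop :=
      Real.tendsto_log_atTop.const_mul_atTop (by norm_num)
    have h2 := tendsto_atBot_add_const_left atTop (3 : ℝ) (tendsto_neg_atTop_atBot.comp h1)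
    refine h2.congr' (Eventually.of_forall fun x ↦ ?_)
    simp only [Function.comp]; ring
  refine tendsto_atBot_mono' atTop ?_ hlin
  filter_upwards [eventually_ge_atTop (1 : ℝ)] with x hx
  exact hlb_le_of_riemannHypothesis hRH hx

/-- **RH ⇒ `B(x) ≤ −A` eventually, for every `A`.** [cite: Suzuki2024, Thm 1] -/
theorem eventually_hlb_le_of_riemannHypothesis (hRH : RiemannHypothesis) (A : ℝ) :
    ∀ᶠ x in atTop, hlb x ≤ -A :=
  (tendsto_hlb_atBot_of_riemannHypothesis hRH).eventually (eventually_le_atBot (-A))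

/-- **RH ⇒ `chebyshevHalfLineBias x → −∞`.** [cite: Suzuki2024, Thm 1] -/
theorem tendsto_chebyshevHalfLineBias_atBot_of_riemannHypothesis (hRH : RiemannHypothesis) :
    Tendsto chebyshevHalfLineBias atTop atBot := by
  refine (tendsto_hlb_atBot_of_riemannHypothesis hRH).congr' ?_
  filter_upwards [eventually_gt_atTop (0 : ℝ)] with x hx
  exact hlb_eq_chebyshevHalfLineBias hx

/-! ## §4 The screw function read through `B` (unconditional rearrangements) -/

/-- `Ψ(log x) ≥ −B(x) − 9 − (log x)/2 · L` would be the lower companion; we record the useful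
direction: **a lower bound on `Ψ` at `t = log x` is an upper bound on `B(x)`**:
`Ψ(log x) ≥ −M ⇒ B(x) ≤ 3 + M − (5/2) log x` (`x ≥ 1`). [cite: Suzuki2023, (1.1)] -/
theorem hlb_le_of_zetaScrew_ge {x M : ℝ} (hx : 1 ≤ x) (hΨ : -M ≤ zetaScrew (Real.log x)) :
    hlb x ≤ 3 + M - 5 / 2 * Real.log x := by
  have h := hlb_add_zetaScrew_le hx
  linarith

/-- **`Ψ(t) ≥ −M` for all large `t` ⇒ `B(x) ≤ 3 + M − (5/2) log x` for all large `x`** (in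
particular `B` is eventually bounded above — which is RH-strength by MV 15.3 for `B`, see the
dictionary file). [cite: Suzuki2023, (1.1) and Thm 1.7] -/
theorem eventually_hlb_le_of_zetaScrew_ge {M : ℝ} (hΨ : ∀ᶠ t in atTop, -M ≤ zetaScrew t) :
    ∀ᶠ x in atTop, hlb x ≤ 3 + M - 5 / 2 * Real.log x := by
  filter_upwards [Real.tendsto_log_atTop.eventually hΨ, eventually_ge_atTop (1 : ℝ)] with x h hx
  exact hlb_le_of_zetaScrew_ge hx h

/-- **`Ψ(t) ≥ −A e^{τ t}` for all large `t` ⇒ `B(x) ≤ (A + 3) x^τ` for all large `x`** (`τ ≥ 0`):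
one-sided exponential-scale lower readers of the screw function are one-sided power-scale upper
readers of `B`. [cite: Suzuki2023, (1.1)] -/
theorem eventually_hlb_le_rpow_of_zetaScrew_ge {A τ : ℝ} (hτ : 0 ≤ τ)
    (hΨ : ∀ᶠ t in atTop, -(A * Real.exp (τ * t)) ≤ zetaScrew t) :
    ∀ᶠ x in atTop, hlb x ≤ (A + 3) * x ^ τ := by
  filter_upwards [Real.tendsto_log_atTop.eventually hΨ, eventually_ge_atTop (1 : ℝ)] with x h hx
  have hx0 : 0 < x := by linarith
  have hexp : Real.exp (τ * Real.log x) = x ^ τ := by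
    rw [Real.rpow_def_of_pos hx0, mul_comm]
  rw [hexp] at h
  have h1 := hlb_add_zetaScrew_le hx
  have hxτ : 1 ≤ x ^ τ := Real.one_le_rpow hx hτ
  have hlog : 0 ≤ Real.log x := Real.log_nonneg hx
  nlinarith

end Summit.RiemannHypothesis.RiemannHypothesis.Theorems.PfPersistenceHalfLineBiasScrew

end
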